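import Summits.QuantumFields.YangMills.Theorems.BalabanUVNodesN07SplitClauseHeadKnitMeetNormalisedTower
import Summits.QuantumFields.YangMills.Theorems.BalabanUVNodesN07NormalisationOfRecordWide
import HarnessLib

/-!
# N07 [B11] (= [15] = [Balaban1985Variational]) Sect. F — **THE ONE CONDITIONAL PREMISE OF THE KNIT OF RECORD, NAMED: `HThm4Rec`** = «[6] Theorem 4 ∕ Proposition 6 — the
# (1.29)-NORMALISED local Landau gauge with [15] (152)'s letters on the whole (1.131) tower and (153) — FOR THE RECORD's OWN AVERAGING STRUCTURE ((0.4) weights `avOfRecord`, CENTRED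
# blocks `Setup.emb`, RADIAL contours)» in PROPOSITION-6 FORM at every meeting datum of a separated run, and the DOOR `HThm4Rec → HS3NORM-67c` with `Nrm := NrmOfRecordWide` (plan g90
# RULING A3, 2026-08-29: «W1 resting state under the N4 label»; item (P1)(iii′) = S1ᶜ)

Cell `pub-ymgap`, width seat `pub-ymgap-dag-n07-w3` g8 — LEAD PEN of plan g90's SPEC D90-S3W1 (P1)(iii) → (iii′) (RULING A3, cell bus 2026-08-29 ≈01:18Z: «(2) HS3NORM's door = CONDITIONAL
DOOR S1ᶜ (n07-w3 g8, M): a named Prop `HThm4Rec` := «[6] Theorem 4 at U₀ = 1 … FOR THE RECORD STRUCTURE» … plus the door theorem `HThm4Rec … → <HS3NORM-67c clause with Nrm :=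
NrmOfRecordWide>`; HONEST LABEL printed in its header: CONDITIONAL — N07 NOT claimable on road (β) (№240 (B)(iv)) while `HThm4Rec` is undischarged; its only discharge road is an «N05-REC»
lane re-running the [6] engine over the record structure (L++), NOT commissioned»).  Stage-0 reply of record: `HOME/pub-ymgap-dag-n07-w3/SPEC-REPLY-P1iii.md` (⚑ BASEPOINT, ⚑ AXIAL-SURFACE);
dag-n07-e g25's `LOCATED-N1-NEAR-ROWS.md` (⚑ N1-NEAR-ROWS, trigger (k8)).  `--kind definition --supports stmt-QuantumFields-20541 --as helper` (K0⁷; count-neutral).  ONE `def` + theorems.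
CONSUMED BY NAME, nothing modified: dag-n07-e's MODULE 67c `…N07SplitClauseHeadKnitMeetNormalisedTower` (HS3NORM-67c's clause, byte for byte) and MODULE 60′
`…N07NormalisationOfRecordWide` (`NrmOfRecordWide`, the `Nrm` text of record), my g7 `…N07DatumGauge152Guarded` (`two_mul_pow_le_sitesPerDir_of_levelGuard`).
[15] = [Balaban1985Variational]; [6] = [Balaban1985RegularSpaces]; [3] = [Balaban1985Averaging]; [I] = [Balaban1987RG1].

WHY A NAMED PREMISE (three located points of 2026-08-29, caught at Stage 0, nothing filed against any of them; full text: `HOME/pub-ymgap-dag-n07-w3/SPEC-REPLY-P1iii.md`,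
dag-n07-e's `LOCATED-N1-NEAR-ROWS.md`, dag-n05-e's `SIZING-HThm4Rec.md`).  Print has ONE block averaging ([4] = [3] (42), blocks nested through their lowest corner), the tree has
TWO (N05's member types [6] literally; NODE 00's record is [I]'s (0.4) averaging on centre-nested tori with radial contours): (⚑ BASEPOINT) the two (1.29) normalisations differ at
third order; (⚑ AXIAL-SURFACE) the typed Theorem-4 engine accepts only MEMBER-axial input (`InAxOne`), so it cannot normalise the record-axial quotient the chart's δ-type near rows
(160) need; (⚑ N1-NEAR-ROWS) a member-axial normalisation makes those rows ε-type, which the budget cannot absorb.  [I] p. 253–254 LICENSES the record structure («The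
considerations and results … are valid universally for all averages satisfying the above properties … The proofs are in most cases unchanged») but PROVES nothing for it;
re-running the [6] engine over it is «N05-REC» (dag-n05-e: ≈ 400 files ∕ 187 k lines, L++, not commissioned).  Hence ONE conditional premise, in PROPOSITION-6 FORM (input: the
token's (1.7)∕(1.9) smallness on the record regions; output: the normalised gauge with its letters) — the form [15] p. 301 invokes and whose engine-structure analogue is a
theorem (`B8Prop6DentedCubeMemberScalarGammaHolds`); a Theorem-4 form would only move the record twin of [6] (1.130)–(1.134) to an equally doorless door side.

WHAT THIS FILE DECLARES (one definition, NEVER asserted; a HYPOTHESIS of the knit of record) AND PROVES (bookkeeping only).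
* §1 `HThm4Rec F N Mc ρ κ a₀ : Prop` — for every SEPARATED run `(ν, M, g, K, k, s)` with the collar floor `(11·4 + 4ρ + Mc + 3)·L ≤ ν.M₁` and the no-wrap bound `Mc + 44 + 6ρ ≤ sitesPerDir k`,
  every tolerance profile `0 < ε_m ≤ a₀` (`m ≤ k`) with `ε_m ≤ 2ε_{m+1}`, every `SU(N)` field `U` of `T_η` in the token's (1.7)∕(1.9) class on the record regions at all levels `≤ k`, every
  level `1 ≤ j ≤ k` (`j ≤ m + K`) and every grid datum `idx` whose print box MEETS `Ω_j` (a point within `3` of a lift of a site of `Ω_j`): `∃ u A` with HS3NORM-67c's NINE rows VERBATIM at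
  level `j` — the print-box gauge equation, (T1) the gauge equation on the whole tower `□₀`, (T2) the level-weighted letters `‖A b‖ < κ·ε_j·L^{j−j′}` on every `□_{j′}`, the four print-box
  letters `< κ·ε_j`, (153) for every family kernel-finer than the MEET `cubeDomains ⊓ domainsOfSeq s.Ω j`, and `NrmOfRecordWide F N Mc ρ ν M g K k s U j idx u A` ([3] (81) at the
  record: `∃ w` residual radial-axial, `h` the centre-rooted top axial gauge on `□̃`, `gaugeAvgIter (loopAvgBlockOp expMeanLogSU) (h̄·w·u⁻¹) j′ = 1` on the meet's cells).  It drops, of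
  HS3NORM's binders, exactly what [6] Prop. 6 does not read: the data `W` and its smallness `δ`, `AgreeOn`, `IsCritOnFibre`, the clean-datum disjunction, the guard `Adm` (replaced by
  its two consequences).  Guarded by `0 < κ` INSIDE (at `κ ≤ 0` the strict letters would make the body false at every meeting datum; dag-n07-e's veto point (γ)); (153) is stated for the MEET family itself (print's «R determined by {Ω′_j}»; every kernel-finer `D′` follows in the door by `RE_eq_zero_of_ker_le` — dag-n05-e's (k9)-3).
* §1b `HThm4RecEx F N Mc B₃` — THE PREMISE OF RECORD: `∃ ρ₀ B₁ c₁`, `HThm4Rec` at `ρ := ρ₀·L`, `κ := b9OfP … B₁ · B₃`, `a₀ := a0OfP … ∕ B₃` (dag-n05-e's (k9)-1: the only dischargeable binding).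
* §2 ★★★ `hS3NORM67c_of_hThm4Rec` — THE DOOR: from `HThm4Rec F N Mc ρ κ a₀` and `0 < κ` (+ the knit's own guard implication and the two side conditions of its constants `c, c₀`, as
  MODULE 67c displays them), HS3NORM-67c's clause with `Nrm := NrmOfRecordWide F N Mc ρ`, BYTE FOR BYTE (the ∀-kernel-finer (153) rows by `RE_eq_zero_of_ker_le` from the meet row).
* §3 ★★★ `datumGaugeSplitTopStepCoreG_of_hThm4Rec_of_chartMeetTower` — MODULE 67c's knit `datumGaugeSplitTopStepCoreG_of_normalisedGauge_of_chartMeetTower` AT `Nrm := NrmOfRecordWide F N Mc ρ`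
  with HS3NORM replaced by `(0 < κ) (hT : HThm4Rec F N Mc ρ κ a₀)` and every other binder byte for byte: THE KNIT OF RECORD UNDER THE ONE NAMED PREMISE.
* A6 certificate (the premise's conclusion shape inhabited at the trivial field `U := 1`): sibling module `…N07Thm4RecordStructureA6`.
HONEST LABEL (binding).  `HThm4Rec` is a CONDITIONAL PREMISE: a classical statement print-LICENSED ([I] p. 253–254) and NOT print-PROVED for the (0.4) structure, of [6]-Prop-6 ∕ Thm-4
class («N05-REC», L++, nobody sized); this file DISCHARGES NOTHING of it.  With it the knit of record is CONDITIONAL; N07 is NOT claimable on road (β) (director-ym №240 (B)(iv)) while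
`HThm4Rec` is undischarged; K0⁷ ∕ K1⁹ NOT closed; N07 ∕ N05 NOT discharged; counts unmoved (typed 28∕28 · discharged 7∕28); one finite 𝕋⁴ programme at fixed ε — R4 closes the
conditional finite-𝕋⁴ rung `BalabanLadder.UV` ONLY; the YM mass gap (Clay) is NOT proved by any of this; nothing continuum ∕ ℝ⁴ ∕ OS.  ONE `def`, no `instance`, no `notation`, no `sorry`.

References: [15] (147)–(153) p. 301; [6] Thm. 4 p. 88, Prop. 6 (1.130)–(1.138) pp. 98–99, (1.29) p. 81, (1.38) p. 82; [3] (2) p. 17, (78)–(81) p. 30; [I] (0.4)–(0.9) pp. 253–254.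
-/

set_option autoImplicit false

noncomputable section

open scoped BigOperators Matrix.Norms.L2Operator

namespace Summit.QuantumFields.YangMills.BalabanUVNodes.N07Thm4RecordStructure

open Literature.MathematicalPhysics.QuantumFieldTheory.Balaban1983to89
open Literature.MathematicalPhysics.QuantumFieldTheory.Balaban1983to89.Node00
open Literature.MathematicalPhysics.QuantumFieldTheory.Balaban1983to89.B15DeterminingSets
open Literature.MathematicalPhysics.QuantumFieldTheory.Balaban1983to89.B12RegularSpaces111 (gaugeU expI grad)
open B15Eq112TorusCover (cover)
open B14DomainGeom (Pt Within)
open B8Eq131Cubes (sqLo sqHi box cube)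
open B5Eq117TorusCarriers (Mk)
open B5Eq118OneStroke (iterBlockOf)
open B5Prop12FieldsLattice (distSite)
open B6SectADomainsV1 (Domains)
open B6SectAOperatorsV1 (BondIdx RE dsE QpE)
open Summit.QuantumFields.YangMills.Theorems.K0FlatCubeOpsTextP (flatH)
open Summit.QuantumFields.YangMills.BalabanUVNodes.N07HalvingStepTopOfLocalLetters (Letters10On)
open Summit.QuantumFields.YangMills.BalabanUVNodes.N07LocalLettersCoreGuarded (DatumGaugeSplitTopStepCoreG)
open Summit.QuantumFields.YangMills.BalabanUVNodes.N07SplitClauseHeadKnitMeetNormalisedTower (datumGaugeSplitTopStepCoreG_of_normalisedGauge_of_chartMeetTower)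
open Literature.MathematicalPhysics.QuantumFieldTheory.BalabanImbrieJaffe1984to88.BIJ85AxialPropagator411 (BondSpace)
open T4Continuum (T4Family)
open Summit.QuantumFields.YangMills.BalabanUVNodes.N07NormalisationOfRecordWide (NrmOfRecordWide)
open Summit.QuantumFields.YangMills.BalabanUVNodes.N07DatumGauge152Guarded (two_mul_pow_le_sitesPerDir_of_levelGuard)

variable (F : T4Family) (N : ℕ) [NeZero N]

/-! ## §1  The named premise -/

/-- **`HThm4Rec` — [6] THEOREM 4 ∕ PROPOSITION 6 WITH [15] (152)–(153) AND «ū_j = 1 ON Λ′_j» FOR THE RECORD's AVERAGING STRUCTURE, PROPOSITION-6 FORM, AT EVERY MEETING DATUM OF A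
SEPARATED RUN** (the ONE conditional premise of N07's knit of record; plan g90 RULING A3).  For the grid-cube size `Mc`, the collar `ρ`, the (152)-letter `κ` and the tolerance ceiling `a₀`:
for every separated run with the collar floor and the no-wrap bound, every tolerance profile in range, every `SU(N)` field in the token's (1.7)∕(1.9) class on the record regions, every
level `1 ≤ j ≤ k` and every datum whose print box meets `Ω_j`, there are a torus gauge `u` and a potential `A` with HS3NORM-67c's nine rows at level `j` and `NrmOfRecordWide … u A`.
Print-LICENSED by [I] p. 253–254 for the (0.4) structure, NOT print-proved for it; NEVER asserted here. [cite: Balaban1985RegularSpaces, Thm. 4 p.88, Prop. 6 (1.130)–(1.138) pp.98–99, (1.29) p.81, (1.38) p.82; Balaban1985Variational, (147)–(153) p.301; Balaban1985Averaging, (78)–(81) p.30; Balaban1987RG1, (0.4)–(0.9) pp.253–254] -/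
def HThm4Rec (Mc ρ : ℕ) (κ a₀ : ℝ) : Prop :=
  0 < κ → ∀ (ν : Stage7Numerics) (M : ℕ) (g : ℕ → ℝ) (K k : ℕ) (s : SeqOfRecord F ν M g K k), Sect2.SeqSeparated ν.M₁ s → 0 < ν.M₁ →
    (11 * 4 + 4 * ρ + Mc + 3) * F.L ≤ ν.M₁ → Mc + 11 * 4 + 6 * ρ ≤ (F.P K).sitesPerDir k → 1 ≤ k →
    ∀ (ε : ℕ → ℝ), (∀ n, n ≤ k → 0 < ε n ∧ ε n ≤ a₀) → (∀ n, n < k → ε n ≤ 2 * ε (n + 1)) →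
    ∀ U : GaugeField (F.P K) 0 (SU N),
    (∀ n, n ≤ k → PlaqSmallOn (Sect2.omegaPlaqsTop s.Ω (suppDomOfRecord F ν K s.Ω) n) (ε n * (F.P K).eta n ^ 2) U) →
    (∀ n, n ≤ k → Sect2.CoDivSmallOn (Sect2.omegaBondsTop s.Ω (suppDomOfRecord F ν K s.Ω) n) (ε n * (F.P K).eta n ^ 3) U) →
    ∀ (j : ℕ) (hk : j ≤ (F.P K).m + (F.P K).K), 1 ≤ j → j ≤ k → ∀ (idx : Pt (F.P K).d),
    (∃ x ∈ box (F.P K).L (cornerP (F.P K) Mc ρ idx) (sideP (F.P K) Mc ρ) j, ∃ y : Pt (F.P K).d, cover (F.P K) y ∈ s.Ω j ∧ Within ((3 : ℕ) : ℤ) x y) →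
    ∃ (u : GaugeTransf (F.P K) 0 (SU N)) (A : PBond (F.P K) 0 → MatA N),
      (∀ b ∈ (Sect2.regionOfSet (F.P K) (cover (F.P K) '' box (F.P K).L (cornerP (F.P K) Mc ρ idx) (sideP (F.P K) Mc ρ) j)).bonds,
        gaugeU (fun x => ιSU N (u x)) (fun b' => ιSU N (U b')) b = expI ((F.P K).eta j) (A b)) ∧
      (∀ b ∈ (Sect2.regionOfSet (F.P K) (cover (F.P K) '' cube (F.P K).L (cornerP (F.P K) Mc ρ idx) (sideP (F.P K) Mc ρ) ρ j 0)).bonds,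
        gaugeU (fun x => ιSU N (u x)) (fun b' => ιSU N (U b')) b = expI ((F.P K).eta j) (A b)) ∧
      (∀ j', j' ≤ j →
        ∀ b ∈ (Sect2.regionOfSet (F.P K) (cover (F.P K) '' cube (F.P K).L (cornerP (F.P K) Mc ρ idx) (sideP (F.P K) Mc ρ) ρ j j')).bonds,
          ‖A b‖ < κ * ε j * ((F.P K).L : ℝ) ^ (j - j')) ∧
      (∀ b ∈ (Sect2.regionOfSet (F.P K) (cover (F.P K) '' box (F.P K).L (cornerP (F.P K) Mc ρ idx) (sideP (F.P K) Mc ρ) j)).bonds,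
        ‖A b‖ < κ * ε j) ∧
      (∀ q ∈ (Sect2.regionOfSet (F.P K) (cover (F.P K) '' box (F.P K).L (cornerP (F.P K) Mc ρ idx) (sideP (F.P K) Mc ρ) j)).dpairs,
        ‖grad ((F.P K).eta j) q.2.1 (fun y => A ⟨y, q.2.2⟩) q.1‖ < κ * ε j) ∧
      (∀ b ∈ Sect2.bondsDeep (cover (F.P K) '' box (F.P K).L (cornerP (F.P K) Mc ρ idx) (sideP (F.P K) Mc ρ) j),
        ‖Sect2.codiffCurlA ((F.P K).eta j) A b.src b.dir‖ < κ * ε j) ∧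
      (∀ b ∈ Sect2.bondsDeep (cover (F.P K) '' box (F.P K).L (cornerP (F.P K) Mc ρ idx) (sideP (F.P K) Mc ρ) j),
        ‖∑ ν' : Fin (F.P K).d, (((F.P K).eta j : ℝ) : ℂ)⁻¹ •
            (grad ((F.P K).eta j) ν' (fun y => A ⟨y, b.dir⟩) (b.src.unshift ν') - grad ((F.P K).eta j) ν' (fun y => A ⟨y, b.dir⟩) b.src)‖ < κ * ε j) ∧
      (∀ φ : MatA N →L[ℂ] ℂ,
        RE (domainsMeet (cubeDomains (F.P K) (cornerP (F.P K) Mc ρ idx) (sideP (F.P K) Mc ρ) ρ j hk) (domainsOfSeq s.Ω j hk)) ((F.P K).eta j)⁻¹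
            (dsE ((F.P K).eta j)⁻¹ (WithLp.toLp 2 fun b => (φ (A b)).re : BondSpace (F.P K))) = 0 ∧
        RE (domainsMeet (cubeDomains (F.P K) (cornerP (F.P K) Mc ρ idx) (sideP (F.P K) Mc ρ) ρ j hk) (domainsOfSeq s.Ω j hk)) ((F.P K).eta j)⁻¹
            (dsE ((F.P K).eta j)⁻¹ (WithLp.toLp 2 fun b => (φ (A b)).im : BondSpace (F.P K))) = 0) ∧
      NrmOfRecordWide F N Mc ρ ν M g K k s U j idx u A

/-! ## §1b  The premise of record, constants bound as print binds them («there exist B₁, c₁») -/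

/-- **THE PREMISE OF RECORD `HThm4RecEx`** (dag-n05-e g34's binding requirement (k9)-1, `SIZING-HThm4Rec.md` §3: «at a κ NOT of the form const(d,L)·B₁·sideP with B₁
existential above it … NO engine twin can ever discharge it»): [6] Prop. 6's constants are EXISTENTIAL — `∃ ρ₀ B₁ c₁` — and the (152)-letter, the tolerance ceiling and the
collar are the record's stub-2′ bindings `κ := b9OfP F Mc (ρ₀·L) B₁ · B₃`, `a₀ := a0OfP F N Mc (ρ₀·L) B₁ c₁ ∕ B₃`, `ρ := ρ₀·L` (my g2∕g6 `TorusCoverGaugeTokensRPrint.b9OfP ∕ a0OfP`: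
`b9OfP ∝ B₁·sideP`, `a0OfP`'s `1∕(8·M′·N·…)` branch).  THIS is the proposition an «N05-REC» engine twin would conclude (n05-e: the engine-structure analogue
`B8Prop6DentedCubeMemberScalarGammaHolds.gaugedBoundB8D_dentedMember_scalar_γ_holds` is unconditional); the knit's assembly binds `HThm4Rec` at exactly these letters
with `∃ ρ₀ B₁ c₁` ABOVE the head's `ρ`, `κ`, `a₀`.  NEVER asserted. [cite: Balaban1985RegularSpaces, Prop. 6 p.99 («There exist constants B₁, c₁»), Thm. 4 p.88; Balaban1987RG1, (0.4) p.253] -/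
def HThm4RecEx (Mc : ℕ) (B₃ : ℝ) : Prop :=
  ∃ (ρ₀ : ℕ) (B₁ c₁ : ℝ), 1 ≤ ρ₀ ∧ 0 ≤ B₁ ∧ 0 < c₁ ∧
    HThm4Rec F N Mc (ρ₀ * F.L) (b9OfP F Mc (ρ₀ * F.L) B₁ * B₃) (a0OfP F N Mc (ρ₀ * F.L) B₁ c₁ / B₃)

/-! ## §2  The door: HS3NORM-67c with `Nrm := NrmOfRecordWide` from `HThm4Rec` -/

/-- ★★★ **THE CONDITIONAL DOOR S1ᶜ** (plan g90 RULING A3 (2)): from the named premise `HThm4Rec F N Mc ρ κ a₀` — together with the knit's own guard implication `Adm … → c ≤ ν.M₁ ∧ k + c₀ ≤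
F.m + K`, the side conditions `(11·4 + 4ρ + Mc + 3)·L ≤ c`, `Mc + 11·4 + 6ρ ≤ 2·L^{c₀}` of its two constants and `0 < B₃`, all displayed by MODULE 67c — the hypothesis HS3NORM-67c of
`…N07SplitClauseHeadKnitMeetNormalisedTower.datumGaugeSplitTopStepCoreG_of_normalisedGauge_of_chartMeetTower` BYTE FOR BYTE at `Nrm := NrmOfRecordWide F N Mc ρ` (the `Nrm` text of record,
MODULE 60′).  Bookkeeping only: the collar floor and the no-wrap bound are read off the guard (as my g7 `…DatumGauge152Guarded.datumGauge152_REfiner153_of_prop6P_guarded`), the tolerances'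
positivity off `0 < δ_n`, `B₃δ_n ≤ ε_n`; the data `W`, `AgreeOn`, `IsCritOnFibre` and the clean-datum disjunction are not read. [cite: Balaban1985Variational, (144) p.300, (147)–(153) p.301; Balaban1985RegularSpaces, Prop. 6 p.99, Thm. 4 p.88, (1.29) p.81; Balaban1987RG1, (0.1) p.251, (0.4) p.253] -/
theorem hS3NORM67c_of_hThm4Rec {ρ Mc : ℕ} {c c₀ : ℕ} (hc : (11 * 4 + 4 * ρ + Mc + 3) * F.L ≤ c) (hc₀ : Mc + 11 * 4 + 6 * ρ ≤ 2 * F.L ^ c₀)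
    (Adm : StepGuard F) (hAdm : ∀ (ν : Stage7Numerics) (M : ℕ) (g : ℕ → ℝ) (K k : ℕ) (s : SeqOfRecord F ν M g K k), Adm ν M g K k s → c ≤ ν.M₁ ∧ k + c₀ ≤ F.m + K)
    {B₃ κ a₀ a₁ : ℝ} (hB₃ : 0 < B₃) (hκ : 0 < κ) (hT : HThm4Rec F N Mc ρ κ a₀) :
    ∀ (ν : Stage7Numerics) (M : ℕ) (g : ℕ → ℝ) (K k : ℕ) (s : SeqOfRecord F ν M g K k), Sect2.SeqSeparated ν.M₁ s → 0 < ν.M₁ →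
      Adm ν M g K k s → 1 ≤ k →
      ∀ (ε δ : ℕ → ℝ),
      (∀ n, n ≤ k → 0 < δ n ∧ δ n ≤ a₁) → (∀ n, n < k → δ n ≤ 2 * δ (n + 1)) → (∀ n, n < k → δ (n + 1) ≤ 2 * δ n) →
      (∀ n, n ≤ k → B₃ * δ n ≤ ε n ∧ ε n ≤ a₀) → (∀ n, n < k → ε n ≤ 2 * ε (n + 1)) → (∀ n, n < k → ε (n + 1) ≤ 2 * ε n) →
      ∀ W : MSField (F.P K) (SU N), Sect2.DataSmall7PTop (avOfRecord F N K) s.Ω (suppDomOfRecord F ν K s.Ω) k δ W →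
      ∀ U : GaugeField (F.P K) 0 (SU N),
      (∀ n, n ≤ k → PlaqSmallOn (Sect2.omegaPlaqsTop s.Ω (suppDomOfRecord F ν K s.Ω) n) (ε n * (F.P K).eta n ^ 2) U) →
      (∀ n, n ≤ k → Sect2.CoDivSmallOn (Sect2.omegaBondsTop s.Ω (suppDomOfRecord F ν K s.Ω) n) (ε n * (F.P K).eta n ^ 3) U) →
      AgreeOn (genSet s.Ω k) (avgFamily (avOfRecord F N K) U) W → IsCritOnFibre F N K (genSet s.Ω k) W U →
      ∀ (n : ℕ) (hk : K - n ≤ (F.P K).m + (F.P K).K), 1 ≤ K - n → K - n ≤ k → ∀ (idx : Pt (F.P K).d),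
      (∃ x ∈ box (F.P K).L (cornerP (F.P K) Mc ρ idx) (sideP (F.P K) Mc ρ) (K - n), ∃ y : Pt (F.P K).d, cover (F.P K) y ∈ s.Ω (K - n) ∧ Within ((3 : ℕ) : ℤ) x y) →
      (K - n = k ∨ ∀ z ∈ box (F.P K).L (cornerP (F.P K) Mc ρ idx - ((2 * ρ : ℕ) : Pt (F.P K).d)) (sideP (F.P K) Mc ρ + 2 * (2 * ρ)) (K - n),
        cover (F.P K) z ∉ s.Ω (K - n + 1)) →
      ∃ (u : GaugeTransf (F.P K) 0 (SU N)) (A : PBond (F.P K) 0 → MatA N),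
      (∀ b ∈ (Sect2.regionOfSet (F.P K) (cover (F.P K) '' box (F.P K).L (cornerP (F.P K) Mc ρ idx) (sideP (F.P K) Mc ρ) (K - n))).bonds,
        gaugeU (fun x => ιSU N (u x)) (fun b' => ιSU N (U b')) b = expI ((F.P K).eta (K - n)) (A b)) ∧
      (∀ b ∈ (Sect2.regionOfSet (F.P K) (cover (F.P K) '' cube (F.P K).L (cornerP (F.P K) Mc ρ idx) (sideP (F.P K) Mc ρ) ρ (K - n) 0)).bonds,
        gaugeU (fun x => ιSU N (u x)) (fun b' => ιSU N (U b')) b = expI ((F.P K).eta (K - n)) (A b)) ∧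
      (∀ j', j' ≤ K - n →
        ∀ b ∈ (Sect2.regionOfSet (F.P K) (cover (F.P K) '' cube (F.P K).L (cornerP (F.P K) Mc ρ idx) (sideP (F.P K) Mc ρ) ρ (K - n) j')).bonds,
          ‖A b‖ < κ * ε (K - n) * ((F.P K).L : ℝ) ^ (K - n - j')) ∧
      (∀ b ∈ (Sect2.regionOfSet (F.P K) (cover (F.P K) '' box (F.P K).L (cornerP (F.P K) Mc ρ idx) (sideP (F.P K) Mc ρ) (K - n))).bonds,
        ‖A b‖ < κ * ε (K - n)) ∧
      (∀ q ∈ (Sect2.regionOfSet (F.P K) (cover (F.P K) '' box (F.P K).L (cornerP (F.P K) Mc ρ idx) (sideP (F.P K) Mc ρ) (K - n))).dpairs,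
        ‖grad ((F.P K).eta (K - n)) q.2.1 (fun y => A ⟨y, q.2.2⟩) q.1‖ < κ * ε (K - n)) ∧
      (∀ b ∈ Sect2.bondsDeep (cover (F.P K) '' box (F.P K).L (cornerP (F.P K) Mc ρ idx) (sideP (F.P K) Mc ρ) (K - n)),
        ‖Sect2.codiffCurlA ((F.P K).eta (K - n)) A b.src b.dir‖ < κ * ε (K - n)) ∧
      (∀ b ∈ Sect2.bondsDeep (cover (F.P K) '' box (F.P K).L (cornerP (F.P K) Mc ρ idx) (sideP (F.P K) Mc ρ) (K - n)),
        ‖∑ ν' : Fin (F.P K).d, (((F.P K).eta (K - n) : ℝ) : ℂ)⁻¹ •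
            (grad ((F.P K).eta (K - n)) ν' (fun y => A ⟨y, b.dir⟩) (b.src.unshift ν') - grad ((F.P K).eta (K - n)) ν' (fun y => A ⟨y, b.dir⟩) b.src)‖ <
          κ * ε (K - n)) ∧
      (∀ D' : Domains (F.P K), LinearMap.ker (QpE D') ≤
          LinearMap.ker (QpE (domainsMeet (cubeDomains (F.P K) (cornerP (F.P K) Mc ρ idx) (sideP (F.P K) Mc ρ) ρ (K - n) hk) (domainsOfSeq s.Ω (K - n) hk))) →
        ∀ φ : MatA N →L[ℂ] ℂ,
        RE D' ((F.P K).eta (K - n))⁻¹ (dsE ((F.P K).eta (K - n))⁻¹ (WithLp.toLp 2 fun b => (φ (A b)).re : BondSpace (F.P K))) = 0 ∧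
        RE D' ((F.P K).eta (K - n))⁻¹ (dsE ((F.P K).eta (K - n))⁻¹ (WithLp.toLp 2 fun b => (φ (A b)).im : BondSpace (F.P K))) = 0) ∧
      NrmOfRecordWide F N Mc ρ ν M g K k s U (K - n) idx u A := by
  intro ν M g K k s hsep hM₁ hadm hk1 ε δ hδ _ _ hεr hcomp _ W _ U h17 h19 _ _ n hk hn1 hnk idx hdat _
  obtain ⟨hcν, hlevF⟩ := hAdm ν M g K k s hadm
  -- the collar floor and the no-wrap bound, read off the guard
  have hfl : (11 * 4 + 4 * ρ + Mc + 3) * F.L ≤ ν.M₁ := hc.trans hcν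
  have hlevP : k + c₀ ≤ (F.P K).m + (F.P K).K := by rw [T4Family.P_m, T4Family.P_K]; exact hlevF
  have hlev : Mc + 11 * 4 + 6 * ρ ≤ (F.P K).sitesPerDir k := by
    refine hc₀.trans ?_
    have := two_mul_pow_le_sitesPerDir_of_levelGuard (P := F.P K) le_rfl hlevP
    rwa [T4Family.P_L] at this
  -- the tolerances' range
  have hε : ∀ m, m ≤ k → 0 < ε m ∧ ε m ≤ a₀ := fun m hm =>
    ⟨lt_of_lt_of_le (mul_pos hB₃ (hδ m hm).1) (hεr m hm).1, (hεr m hm).2⟩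
  obtain ⟨u, A, h1, hT1, hT2, h2, h3, h4, h5, h6, hN⟩ := hT hκ ν M g K k s hsep hM₁ hfl hlev hk1 ε hε hcomp U h17 h19 (K - n) hk hn1 hnk idx hdat
  exact ⟨u, A, h1, hT1, hT2, h2, h3, h4, h5, fun D' hD' φ => ⟨RE_eq_zero_of_ker_le hD' (h6 φ).1, RE_eq_zero_of_ker_le hD' (h6 φ).2⟩, hN⟩


/-! ## §3  The knit of record under the named premise (MODULE 67c with HS3NORM discharged by `HThm4Rec`) -/

open scoped Classical in
/-- ★★★ **THE MEET KNIT OF RECORD UNDER THE ONE CONDITIONAL PREMISE** — dag-n07-e's MODULE 67c `datumGaugeSplitTopStepCoreG_of_normalisedGauge_of_chartMeetTower` at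
`Nrm := NrmOfRecordWide F N Mc ρ` (the text of record, MODULE 60′) with its HS3NORM-67c premise DISCHARGED by `hS3NORM67c_of_hThm4Rec`: every other binder of 67c BYTE FOR BYTE (structural
letters, the guard and its two implications, the token letters, HLETTERS-NORM, HBUDGET-NORM, HCHART-MEET-NORM-67c read at `NrmOfRecordWide`), plus `hT : HThm4Rec F N Mc ρ κ a₀` in place of
HS3NORM ⟹ the guarded per-datum token `DatumGaugeSplitTopStepCoreG F N suppDom Mc ρ Adm B₃ C θ Q κ a₀ a₁`.  CONDITIONAL (HONEST LABEL of the header): HCHART-MEET-NORM ∕ HLETTERS ∕ HBUDGET stay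
displayed (the chart lane's ADAPTER, plan A3 (4)); `HThm4Rec` is the premise nobody is sized to discharge.
[cite: Balaban1985Variational, (144) p.300, (147)–(159) pp.301–303, Prop. 8 p.304; Balaban1985RegularSpaces, Thm. 4 p.88, Prop. 6 p.99, (1.29) p.81; Balaban1987RG1, (0.4) p.253] -/
theorem datumGaugeSplitTopStepCoreG_of_hThm4Rec_of_chartMeetTower :
    ∃ (Mh₀ R₀ : ℕ) (CH δH BH : ℝ), 0 ≤ CH ∧ 0 < δH ∧ 0 < BH ∧
    ∀ {ρ : ℕ}
      -- structural letters: grid cube `Mc`, block height `a′` (`M_h = L^{a′} ≥ M_h⁰`), `R ≥ R₀`, the collar `ρ` with `L·M_h ∣ ρ`, `R·L·M_h ≤ ρ`, `L ≤ ρ`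
      {Mc Mh R a' : ℕ} (_ : 1 ≤ Mc) (_ : Mc ≤ ρ) (_ : Mh = F.L ^ a') (_ : Mh₀ ≤ Mh) (_ : R₀ ≤ R) (_ : F.L * Mh ∣ ρ) (_ : R * (F.L * Mh) ≤ ρ) (hLρ : F.L ≤ ρ)
      -- the two constants of the plan's V20-G guard `c ≤ ν.M₁ ∧ k + c₀ ≤ F.m + K` and their side conditions (as in FILE D)
      {c c₀ : ℕ} (_ : (11 * 4 + 4 * ρ + Mc + 3) * F.L ≤ c) (_ : Mc + 11 * 4 + 6 * ρ ≤ 2 * F.L ^ c₀) (_ : F.m ≤ c₀) (_ : a' + 3 ≤ c₀)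
      -- ★ THE GUARD: any step guard implying the V20-G conjuncts AND the run's grid numerics the meet's (2.1) needs (`hgran`, `hdiv`)
      (Adm : StepGuard F) (_ : ∀ (ν : Stage7Numerics) (M : ℕ) (g : ℕ → ℝ) (K k : ℕ) (s : SeqOfRecord F ν M g K k), Adm ν M g K k s → c ≤ ν.M₁ ∧ k + c₀ ≤ F.m + K)
      (_ : ∀ (ν : Stage7Numerics) (M : ℕ) (g : ℕ → ℝ) (K k : ℕ) (s : SeqOfRecord F ν M g K k), Adm ν M g K k s → ∀ j : ℕ, 1 ≤ j → j ≤ k →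
        F.L * Mh ∣ M * RkOfRecord (F.P K).L ν.r (g j) ∧ dCubeSide (F.P K).L M (RkOfRecord (F.P K).L ν.r (g j)) j ∣ (F.P K).sitesPerDir 0)
      -- the token's letters, `0 < B₃`, the FREE (152)-letter `κ ≥ 0`, the (163)-type letter `θ_H` of the `H` doors
      {B₃ C θ Q κ a₀ a₁ θH : ℝ} (_ : 0 < B₃) (_ : 0 ≤ C) (_ : 0 ≤ θ) (_ : 0 ≤ Q) (_ : 0 ≤ κ) (_ : 8 * CH * BH * Real.exp (-(δH * (ρ : ℝ))) ≤ θH)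
      -- the chart side's PER-LEVEL SIZE LETTERS, functions of the letters `(ε, δ)` and the level only — NO shear letters `σ ∕ v ∕ av`
      (β₁ β₂ s' t₁ : (ℕ → ℝ) → (ℕ → ℝ) → ℕ → ℝ)
      -- ★ HLETTERS-NORM (RANGED): signs only, IN THE TOKEN's RANGE `0 < δ_j ≤ a₁`, `B₃δ_j ≤ ε_j ≤ a₀`
      (_ : ∀ (ε δ : ℕ → ℝ) (j : ℕ), 0 < δ j → δ j ≤ a₁ → B₃ * δ j ≤ ε j → ε j ≤ a₀ → 0 ≤ β₁ ε δ j ∧ 0 ≤ β₂ ε δ j ∧ 0 ≤ s' ε δ j)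
      -- ★ HBUDGET-NORM (RANGED): thresholds above FILE C's two floors summing STRICTLY below the token's threshold — no `t_D`, no `C_S·B_S`
      (_ : ∀ (K : ℕ) (ε δ : ℕ → ℝ) (j : ℕ), 0 < δ j → δ j ≤ a₁ → B₃ * δ j ≤ ε j → ε j ≤ a₀ → ∃ t₂ t₃ : ℝ,
        1 / 4 * ((sideP (F.P K) Mc ρ : ℕ) : ℝ) * max (4 * CH * BH * β₁ ε δ j) (θH * β₂ ε δ j) < t₂ ∧ 2 * CH * BH * s' ε δ j < t₃ ∧
        t₁ ε δ j + t₂ + t₃ < C * δ j + θ * ε j + Q * ε j ^ 2)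
      -- ★ THE ONE CONDITIONAL PREMISE OF RECORD (plan g90 RULING A3): `HThm4Rec` at a POSITIVE (152)-letter — HS3NORM-67c's door at `Nrm := NrmOfRecordWide`
      (_ : 0 < κ) (hT : HThm4Rec F N Mc ρ κ a₀)
      -- ★ HCHART-MEET-NORM-67c: the chart lane's per-datum deliverable at PRINT's (150) FAMILY `D″` UNDER THE NORMALISED GAUGE — print's (154)–(159), shear-free — now GIVEN (152) on the
      --   whole tower ((T1) gauge equation on `□₀`, (T2) level-weighted letters on every `□_{j′}`): the FAR rows are free (`B c := Q_c(A)`)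
      (_ : ∀ (ν : Stage7Numerics) (M : ℕ) (g : ℕ → ℝ) (K k : ℕ) (s : SeqOfRecord F ν M g K k), Sect2.SeqSeparated ν.M₁ s → 0 < ν.M₁ →
        Adm ν M g K k s → 1 ≤ k →
        ∀ (ε δ : ℕ → ℝ),
        (∀ n, n ≤ k → 0 < δ n ∧ δ n ≤ a₁) → (∀ n, n < k → δ n ≤ 2 * δ (n + 1)) → (∀ n, n < k → δ (n + 1) ≤ 2 * δ n) →
        (∀ n, n ≤ k → B₃ * δ n ≤ ε n ∧ ε n ≤ a₀) → (∀ n, n < k → ε n ≤ 2 * ε (n + 1)) → (∀ n, n < k → ε (n + 1) ≤ 2 * ε n) →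
        ∀ W : MSField (F.P K) (SU N), Sect2.DataSmall7PTop (avOfRecord F N K) s.Ω (suppDomOfRecord F ν K s.Ω) k δ W →
        ∀ U : GaugeField (F.P K) 0 (SU N),
        (∀ n, n ≤ k → PlaqSmallOn (Sect2.omegaPlaqsTop s.Ω (suppDomOfRecord F ν K s.Ω) n) (ε n * (F.P K).eta n ^ 2) U) →
        (∀ n, n ≤ k → Sect2.CoDivSmallOn (Sect2.omegaBondsTop s.Ω (suppDomOfRecord F ν K s.Ω) n) (ε n * (F.P K).eta n ^ 3) U) →
        AgreeOn (genSet s.Ω k) (avgFamily (avOfRecord F N K) U) W → IsCritOnFibre F N K (genSet s.Ω k) W U →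
        ∀ (n : ℕ) (hk : K - n ≤ (F.P K).m + (F.P K).K), 1 ≤ K - n → K - n ≤ k → ∀ (idx : Pt (F.P K).d),
        -- MEETING DATUMS ONLY: the print box has a point within `3` of a lift of a site of `Ω_{K−n}`
        (∃ x ∈ box (F.P K).L (cornerP (F.P K) Mc ρ idx) (sideP (F.P K) Mc ρ) (K - n), ∃ y : Pt (F.P K).d, cover (F.P K) y ∈ s.Ω (K - n) ∧ Within ((3 : ℕ) : ℤ) x y) →
        -- PRINT-MARGIN-CLEAN DATUMS ONLY (print p. 300 + (144)'s margin cube «□̃» = the print box WIDENED BY `2ρ` BLOCKS): top level, or «□̃» misses `Ω_{j+1}`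
        (K - n = k ∨ ∀ z ∈ box (F.P K).L (cornerP (F.P K) Mc ρ idx - ((2 * ρ : ℕ) : Pt (F.P K).d)) (sideP (F.P K) Mc ρ + 2 * (2 * ρ)) (K - n),
          cover (F.P K) z ∉ s.Ω (K - n + 1)) →
        -- THE FAMILY: print's (150) `Ω′_j = □_j (j < k), Ω′_k = □_k ∩ Ω_k`
        ∀ {HVd : Domains (F.P K)}
          (_ : HVd = domainsMeet (cubeDomains (F.P K) (cornerP (F.P K) Mc ρ idx) (sideP (F.P K) Mc ρ) ρ (K - n) hk) (domainsOfSeq s.Ω (K - n) hk))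
          (lo hi : ℕ → Pt (F.P K).d),
        lo 0 = (fun i => ((F.P K).L : ℤ) * (sqLo (F.P K).L (cornerP (F.P K) Mc ρ idx) ρ (K - n) 1 i - 1)) →
        hi 0 = (fun i => ((F.P K).L : ℤ) * (sqHi (F.P K).L (cornerP (F.P K) Mc ρ idx) (sideP (F.P K) Mc ρ) ρ (K - n) 1 i + 1) + (((F.P K).L : ℤ) - 1)) →
        (∀ j', 1 ≤ j' → lo j' = sqLo (F.P K).L (cornerP (F.P K) Mc ρ idx) ρ (K - n) j' - 1) →
        (∀ j', 1 ≤ j' → hi j' = sqHi (F.P K).L (cornerP (F.P K) Mc ρ idx) (sideP (F.P K) Mc ρ) ρ (K - n) j' + 1) →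
        ∃ HV : (BondIdx HVd → MatA N) →ₗ[ℂ] (PBond (F.P K) 0 → MatA N),
          (∀ (Bf : BondIdx HVd → MatA N) (b : PBond (F.P K) 0), HV Bf b = ∑ c, ((flatH (F.P K) (K - n) HVd (Pi.single c 1) b : ℝ) : ℂ) • Bf c) ∧
        ∀ (u : GaugeTransf (F.P K) 0 (SU N)) (A : PBond (F.P K) 0 → MatA N),
        (∀ b ∈ (Sect2.regionOfSet (F.P K) (cover (F.P K) '' box (F.P K).L (cornerP (F.P K) Mc ρ idx) (sideP (F.P K) Mc ρ) (K - n))).bonds,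
          gaugeU (fun x => ιSU N (u x)) (fun b' => ιSU N (U b')) b = expI ((F.P K).eta (K - n)) (A b)) →
        -- (T1) the gauge equation on the WHOLE TOWER `□₀` of the datum
        (∀ b ∈ (Sect2.regionOfSet (F.P K) (cover (F.P K) '' cube (F.P K).L (cornerP (F.P K) Mc ρ idx) (sideP (F.P K) Mc ρ) ρ (K - n) 0)).bonds,
          gaugeU (fun x => ιSU N (u x)) (fun b' => ιSU N (U b')) b = expI ((F.P K).eta (K - n)) (A b)) →
        -- (T2) (152)'s LEVEL-WEIGHTED letters on every `□_{j′}`, `j′ ≤ K − n`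
        (∀ j', j' ≤ K - n →
          ∀ b ∈ (Sect2.regionOfSet (F.P K) (cover (F.P K) '' cube (F.P K).L (cornerP (F.P K) Mc ρ idx) (sideP (F.P K) Mc ρ) ρ (K - n) j')).bonds,
            ‖A b‖ < κ * ε (K - n) * ((F.P K).L : ℝ) ^ (K - n - j')) →
        (∀ b ∈ (Sect2.regionOfSet (F.P K) (cover (F.P K) '' box (F.P K).L (cornerP (F.P K) Mc ρ idx) (sideP (F.P K) Mc ρ) (K - n))).bonds,
          ‖A b‖ < κ * ε (K - n)) →
        (∀ q ∈ (Sect2.regionOfSet (F.P K) (cover (F.P K) '' box (F.P K).L (cornerP (F.P K) Mc ρ idx) (sideP (F.P K) Mc ρ) (K - n))).dpairs,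
          ‖grad ((F.P K).eta (K - n)) q.2.1 (fun y => A ⟨y, q.2.2⟩) q.1‖ < κ * ε (K - n)) →
        (∀ b ∈ Sect2.bondsDeep (cover (F.P K) '' box (F.P K).L (cornerP (F.P K) Mc ρ idx) (sideP (F.P K) Mc ρ) (K - n)),
          ‖Sect2.codiffCurlA ((F.P K).eta (K - n)) A b.src b.dir‖ < κ * ε (K - n)) →
        (∀ b ∈ Sect2.bondsDeep (cover (F.P K) '' box (F.P K).L (cornerP (F.P K) Mc ρ idx) (sideP (F.P K) Mc ρ) (K - n)),
          ‖∑ ν' : Fin (F.P K).d, (((F.P K).eta (K - n) : ℝ) : ℂ)⁻¹ •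
              (grad ((F.P K).eta (K - n)) ν' (fun y => A ⟨y, b.dir⟩) (b.src.unshift ν') - grad ((F.P K).eta (K - n)) ν' (fun y => A ⟨y, b.dir⟩) b.src)‖ <
            κ * ε (K - n)) →
        (∀ D' : Domains (F.P K), LinearMap.ker (QpE D') ≤ LinearMap.ker (QpE HVd) → ∀ φ : MatA N →L[ℂ] ℂ,
          RE D' ((F.P K).eta (K - n))⁻¹ (dsE ((F.P K).eta (K - n))⁻¹ (WithLp.toLp 2 fun b => (φ (A b)).re : BondSpace (F.P K))) = 0 ∧
          RE D' ((F.P K).eta (K - n))⁻¹ (dsE ((F.P K).eta (K - n))⁻¹ (WithLp.toLp 2 fun b => (φ (A b)).im : BondSpace (F.P K))) = 0) →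
        -- ★ THE NORMALISATION of this `u` (print's «ū_j = 1 on Λ′_j»), as delivered by HS3NORM
        NrmOfRecordWide F N Mc ρ ν M g K k s U (K - n) idx u A →
        -- print's (154)–(159): the centre `x_c`, the DATA rows `B` ((160) near, centred; (155) far), the small datum `B′`, the (158)∕(165) summand `A₁`, and `A = A₁ + H_V B − H_V B′`
        ∃ (xc : Pt (F.P K).d) (B B' : BondIdx HVd → MatA N) (A₁ : PBond (F.P K) 0 → MatA N),
          xc ∈ box (F.P K).L (cornerP (F.P K) Mc ρ idx) (sideP (F.P K) Mc ρ) (K - n) ∧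
          (∀ c : BondIdx HVd, ((c.1.1 : ℕ) = K - n ∨ blockOf c.1.2.src ∈ (cubeDomains (F.P K) (cornerP (F.P K) Mc ρ idx) (sideP (F.P K) Mc ρ) ρ (K - n) hk).Om ((c.1.1 : ℕ) + 1)) →
            ‖B c‖ ≤ β₁ ε δ (K - n) * (distSite (Mk (F.P K) (c.1.1 : ℕ)) c.1.2.src (iterBlockOf (c.1.1 : ℕ) (cover (F.P K) xc)) + 1)) ∧
          (∀ c : BondIdx HVd, ¬ ((c.1.1 : ℕ) = K - n ∨ blockOf c.1.2.src ∈ (cubeDomains (F.P K) (cornerP (F.P K) Mc ρ idx) (sideP (F.P K) Mc ρ) ρ (K - n) hk).Om ((c.1.1 : ℕ) + 1)) →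
            ‖B c‖ ≤ β₂ ε δ (K - n) * ((ρ : ℝ) + ((sideP (F.P K) Mc ρ : ℕ) : ℝ))) ∧
          (∀ c, ‖B' c‖ ≤ s' ε δ (K - n)) ∧
          Letters10On (cover (F.P K) '' box (F.P K).L (cornerP (F.P K) Mc ρ idx) (sideP (F.P K) Mc ρ) (K - n)) ((F.P K).eta (K - n)) (t₁ ε δ (K - n)) A₁ ∧
          (∀ b, A b = A₁ b + HV B b - HV B' b)),
      DatumGaugeSplitTopStepCoreG F N (fun ν K Ω => suppDomOfRecord F ν K Ω) Mc ρ Adm B₃ C θ Q κ a₀ a₁ := by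
  obtain ⟨Mh₀, R₀, CH, δH, BH, hCH, hδH, hBH, hmain⟩ := datumGaugeSplitTopStepCoreG_of_normalisedGauge_of_chartMeetTower F N
  refine ⟨Mh₀, R₀, CH, δH, BH, hCH, hδH, hBH, ?_⟩
  intro ρ Mc Mh R a' hMc hMcρ hMha hMh hR hdvd hRρ hLρ c c₀ hc hc₀ hmc₀ hac₀ Adm hAdm₁ hAdm₂ B₃ C θ Q κ a₀ a₁ θH hB₃ hC0 hθ0 hQ0 hκ0 h163
    β₁ β₂ s' t₁ hletters hbudget hκ hT hchart
  exact hmain hMc hMcρ hMha hMh hR hdvd hRρ hLρ hc hc₀ hmc₀ hac₀ Adm hAdm₁ hAdm₂ hB₃ hC0 hθ0 hQ0 hκ0 h163 β₁ β₂ s' t₁ hletters hbudget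
    (NrmOfRecordWide F N Mc ρ) (hS3NORM67c_of_hThm4Rec F N hc hc₀ Adm hAdm₁ hB₃ hκ hT) hchart



end Summit.QuantumFields.YangMills.BalabanUVNodes.N07Thm4RecordStructure

end
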